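import Literature.Geometry.Lorentzian.ChartScalarCurvature
import HarnessLib

/-!
# The conformal transformation law of scalar curvature in dimension three, in a chart

Schoen–Yau, Comm. Math. Phys. 65 (1979), §2 Step 1 (p. 49), use — for the conformal change
`d̃s² = φ⁴ ds²` on a `3`-manifold — *"The well-known formula for the scalar curvature `R̃` is
`R̃ = φ⁻⁵(-8Δφ + Rφ)`"* (Aubin 1982, Ch. 6, §6.3, eq. (1) at `n = 3`; Besse 1987, Thm. 1.159 f)).
In the positive-mass files of this directory that formula is, so far, an explicit *hypothesis*
(`hR`/`hconf` of `ConformalScalarFlat.lean`, `ConformalScalarFlatSign.lean`,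
`PositiveMassConformalProofs.lean`). This file **proves** it for metrics on an open subset
`U : Opens E` of a `3`-dimensional real normed space, entirely in the coordinates of
`ChartCalculus.lean` / `ChartConnection.lean` / `ChartScalarCurvature.lean`; the transfer to an
abstract `3`-manifold (naturality of `S` and `□` under charts) is done in a companion file.
Everything is proved; no named facts are introduced.

## Main results (namespace `Literature.Geometry.Lorentzian.OpensChart`)

Calculus of the components `G' = f • G` of a conformal metric (`f : E → ℝ`, `G` the components
of `g`):
* `fderiv_conformalRepr_apply` — `∂_v (f G)(Y, Z) = ∂_v f · G(Y,Z) + f · ∂_v G(Y, Z)`;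
* `koszulForm_conformalRepr` — the Koszul form (twice the Christoffel symbols of the first kind)
  `K'(p; q, r) = f K(p; q, r) + ∂_q f G(p,r) + ∂_p f G(r,q) − ∂_r f G(q,p)`;
* `fderiv_koszulForm_conformalRepr` — its first derivatives `∂_v K'`, in terms of `∂_v K`
  (the second derivatives of `G`, which cancel in the law), `K`, `∂G`, `∂f`, `∂²f`.

Linear algebra in a `G(x)`-orthonormal basis `β` (`G(x)(βᵢ, βⱼ) = δᵢⱼ`; such bases exist for a
Riemannian `g`, `exists_basis_orthonormal_of_posDef`):
* `gram_inv_of_orthogonal` — the inverse Gram matrix of `c G(x)` is `c⁻¹ 𝟙`;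
* `scalarCurvature_eq_coord_of_orthogonal` — the coordinate formula
  `OpensChart.scalarCurvature_eq_coord` in a `G(x)`-orthogonal basis with `G(x)(βᵢ,βᵢ) = c`,
  in polynomial form: `c³ S = ∑ₖᵢ [c/2 (∂ᵢK(k;k,i) − ∂ₖK(k;i,i)) − ¼ ∑ₐ K(i;i,a)K(k;k,a)
  + ¼ ∑ₐ K(i;k,a)K(k;i,a)]`;
* `dalembertian_eq_sum_of_orthonormal` — `□_g F = ∑ᵢ (∂ᵢ∂ᵢ F − ½ ∑ₗ K(i;i,l) ∂ₗ F)`.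

The transformation law (`dim E = 3`, `β` a `G(x)`-orthonormal basis, `g, g'` smooth metrics on
`U` with components `G` and `f • G`, `f` of class `C²` at `x` with `f x ≠ 0`):
* `scalarCurvature_conformalRepr` — **`f³ S' = f² S − 2 f □_g f + (3/2) |df|²_g`** at `x`, i.e.
  `S(f g) = f⁻¹ S(g) − 2 f⁻² Δ_g f + (3/2) f⁻³ |df|²` (Besse 1987, Thm. 1.159 f) with `n = 3`,
  `f = e^{2φ}`);
* `scalarCurvature_conformalRepr_fourth_power` — **`S(φ⁴ g) = φ⁻⁵ (S(g) φ − 8 □_g φ)`**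
  (Schoen–Yau 1979, p. 49; Aubin 1982, §6.3 (1); Bartnik–Isenberg 2004, §4.1).

## Method

Both scalar curvatures are expanded by `OpensChart.scalarCurvature_eq_coord` (O'Neill 1983,
Lemma 3.38 with Def. 3.53, first-kind form) in the *same* `G(x)`-orthonormal basis; the Koszul
form of `f • G` and its first derivatives are expanded by the Leibniz rule; the second
derivatives of `G` enter both sides through the same terms `∂ᵥ K` and cancel, and what
is left is a polynomial identity in `f(x)`, `∂f`, `∂²f`, `∂G` (closed by `ring`; no symmetry of
`∂G` or `∂²f` is needed). Dimension `3` enters only through the numerical coefficients.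

## References

* R. Schoen, S.-T. Yau, *On the proof of the positive mass conjecture in general relativity*,
  Comm. Math. Phys. 65 (1979) 45–76, §2 Step 1, p. 49.
* T. Aubin, *Nonlinear analysis on manifolds. Monge–Ampère equations*, Grundlehren 252,
  Springer 1982, Ch. 6, §6.3, eq. (1).
* A. Besse, *Einstein Manifolds*, Springer 1987, Thm. 1.159.
* B. O'Neill, *Semi-Riemannian geometry*, Academic Press 1983, Ch. 3, Prop. 3.13, Lemma 3.38,
  Def. 3.53.
-/

noncomputable section

-- instance search through the nested operator type `E →L[ℝ] E →L[ℝ] ℝ` of the metric components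
set_option maxSynthPendingDepth 3

open Set Manifold TopologicalSpace Filter Bundle
open scoped ContDiff Topology Manifold

namespace Literature.Geometry.Lorentzian

namespace OpensChart

/-! ### Calculus of the components `f • G` of a conformal metric -/

section Calculus

variable {E : Type*} [NormedAddCommGroup E] [NormedSpace ℝ E]
  {f : E → ℝ} {G : E → E →L[ℝ] E →L[ℝ] ℝ} {x : E}

/-- The components `f • G` of a conformal metric are differentiable where `f` and `G` are, with
`D(fG)(x) v = f(x) DG(x) v + Df(x) v · G(x)` (Leibniz rule). [folklore] -/
theorem hasFDerivAt_conformalRepr (hf : DifferentiableAt ℝ f x) (hG : DifferentiableAt ℝ G x) :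
    HasFDerivAt (fun y ↦ f y • G y) (f x • fderiv ℝ G x + (fderiv ℝ f x).smulRight (G x)) x :=
  hf.hasFDerivAt.smul hG.hasFDerivAt

/-- **Derivative of the components of a conformal metric**:
`∂ᵥ (f G)(Y, Z) = ∂ᵥf · G(Y, Z) + f · ∂ᵥG(Y, Z)`. [folklore] -/
theorem fderiv_conformalRepr_apply (hf : DifferentiableAt ℝ f x) (hG : DifferentiableAt ℝ G x)
    (v Y Z : E) :
    fderiv ℝ (fun y ↦ f y • G y) x v Y Z =
      fderiv ℝ f x v * G x Y Z + f x * fderiv ℝ G x v Y Z := by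
  rw [(hasFDerivAt_conformalRepr hf hG).fderiv]
  simp only [_root_.add_apply, FunLike.coe_smul, Pi.smul_apply,
    ContinuousLinearMap.smulRight_apply, smul_eq_mul]
  ring

/-- **The Koszul form of a conformal metric.** With `K = koszulForm G` (`K(p; q, r) =
∂_q G(p,r) + ∂_p G(r,q) − ∂_r G(q,p) = 2 g(∇_q p, r)`, O'Neill 1983, Prop. 3.13), the Koszul form
of the components `f • G` is
`K'(p; q, r) = f K(p; q, r) + ∂_q f · G(p,r) + ∂_p f · G(r,q) − ∂_r f · G(q,p)`
(the classical `Γ̃ᵏᵢⱼ = Γᵏᵢⱼ + δᵏⱼ∂ᵢψ + δᵏᵢ∂ⱼψ − gᵢⱼ∂ᵏψ` for `g̃ = e^{2ψ}g`, Besse 1987, Thm. 1.159 a),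
in first-kind form). [cite: Besse1987, Thm. 1.159] -/
theorem koszulForm_conformalRepr (hf : DifferentiableAt ℝ f x) (hG : DifferentiableAt ℝ G x)
    (p q r : E) :
    koszulForm (fun y ↦ f y • G y) x p q r =
      f x * koszulForm G x p q r + fderiv ℝ f x q * G x p r + fderiv ℝ f x p * G x r q
        - fderiv ℝ f x r * G x q p := by
  simp only [koszulForm_apply, fderiv_conformalRepr_apply hf hG]
  ring

/-- `∂ᵥ (y ↦ Df(y) q)(x) = D²f(x)(v, q)` for `f` of class `C²` at `x`. [folklore] -/
theorem hasFDerivAt_fderiv_apply (hf : ContDiffAt ℝ 2 f x) (q : E) :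
    HasFDerivAt (fun y ↦ fderiv ℝ f y q) ((fderiv ℝ (fderiv ℝ f) x).flip q) x := by
  have h1 : DifferentiableAt ℝ (fderiv ℝ f) x :=
    (hf.fderiv_right (m := 1) le_rfl).differentiableAt one_ne_zero
  have h2 := h1.hasFDerivAt.clm_apply (hasFDerivAt_const q x)
  simpa using h2

/-- **The first derivatives of the Koszul form of a conformal metric.** For `f` and `G` of
class `C²` at `x`, differentiating `koszulForm_conformalRepr` (valid near `x`) by the Leibniz
rule:
`∂ᵥK'(p;q,r) = ∂ᵥf K(p;q,r) + f ∂ᵥK(p;q,r) + ∂ᵥ∂_q f G(p,r) + ∂_q f ∂ᵥG(p,r)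
  + ∂ᵥ∂_p f G(r,q) + ∂_p f ∂ᵥG(r,q) − ∂ᵥ∂_r f G(q,p) − ∂_r f ∂ᵥG(q,p)`.
[cite: Besse1987, Thm. 1.159] -/
theorem fderiv_koszulForm_conformalRepr (hf : ContDiffAt ℝ 2 f x) (hG : ContDiffAt ℝ 2 G x)
    (v p q r : E) :
    fderiv ℝ (fun y ↦ koszulForm (fun z ↦ f z • G z) y p q r) x v =
      fderiv ℝ f x v * koszulForm G x p q r
        + f x * fderiv ℝ (fun y ↦ koszulForm G y p q r) x v
        + fderiv ℝ (fderiv ℝ f) x v q * G x p r + fderiv ℝ f x q * fderiv ℝ G x v p r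
        + fderiv ℝ (fderiv ℝ f) x v p * G x r q + fderiv ℝ f x p * fderiv ℝ G x v r q
        - fderiv ℝ (fderiv ℝ f) x v r * G x q p - fderiv ℝ f x r * fderiv ℝ G x v q p := by
  -- differentiability near `x`
  have hfev : ∀ᶠ y in 𝓝 x, DifferentiableAt ℝ f y := by
    have h1 : ∀ᶠ y in 𝓝 x, ContDiffAt ℝ 2 f y := hf.eventually (by simp)
    exact h1.mono fun y hy ↦ hy.differentiableAt (by norm_num)
  have hGev : ∀ᶠ y in 𝓝 x, DifferentiableAt ℝ G y := by
    have h1 : ∀ᶠ y in 𝓝 x, ContDiffAt ℝ 2 G y := hG.eventually (by simp)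
    exact h1.mono fun y hy ↦ hy.differentiableAt (by norm_num)
  have heq : (fun y ↦ koszulForm (fun z ↦ f z • G z) y p q r) =ᶠ[𝓝 x] fun y ↦
      f y * koszulForm G y p q r + fderiv ℝ f y q * G y p r + fderiv ℝ f y p * G y r q
        - fderiv ℝ f y r * G y q p := by
    filter_upwards [hfev, hGev] with y hfy hGy
    exact koszulForm_conformalRepr hfy hGy p q r
  -- the derivatives of the four products at `x`
  have hfx : DifferentiableAt ℝ f x := hf.differentiableAt (by norm_num)
  have hGx : DifferentiableAt ℝ G x := hG.differentiableAt (by norm_num)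
  have hK : HasFDerivAt (fun y ↦ koszulForm G y p q r)
      (fderiv ℝ (fun y ↦ koszulForm G y p q r) x) x :=
    (differentiableAt_koszulForm hG p q r).hasFDerivAt
  have hGa : ∀ a b : E, HasFDerivAt (fun y ↦ G y a b) ((fderiv ℝ G x).flip a |>.flip b) x := by
    intro a b
    have h := ((hGx.hasFDerivAt.clm_apply (hasFDerivAt_const a x)).clm_apply
      (hasFDerivAt_const b x))
    simpa using h
  have h1 := hfx.hasFDerivAt.mul hK
  have h2 := (hasFDerivAt_fderiv_apply hf q).mul (hGa p r)
  have h3 := (hasFDerivAt_fderiv_apply hf p).mul (hGa r q)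
  have h4 := (hasFDerivAt_fderiv_apply hf r).mul (hGa q p)
  have hall : HasFDerivAt (fun y ↦
      f y * koszulForm G y p q r + fderiv ℝ f y q * G y p r + fderiv ℝ f y p * G y r q
        - fderiv ℝ f y r * G y q p) _ x := ((h1.add h2).add h3).sub h4
  rw [heq.fderiv_eq, hall.fderiv]
  simp only [_root_.add_apply, _root_.sub_apply, FunLike.coe_smul, Pi.smul_apply,
    ContinuousLinearMap.flip_apply, smul_eq_mul]
  ring

end Calculus

/-! ### Linear algebra in an orthogonal basis -/

section Gram

variable {ι : Type*} [Fintype ι] [DecidableEq ι]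

/-- The inverse of the scalar matrix `c 𝟙`, `c ≠ 0`, written entrywise: the inverse Gram matrix of
a basis `β` with `B(βᵢ, βⱼ) = c δᵢⱼ` is `c⁻¹ δᵢⱼ` (`gⁱʲ` of an orthogonal frame; O'Neill 1983,
Ch. 3, Lemma 3.36 and p. 60). [folklore] -/
theorem gram_inv_of_orthogonal {c : ℝ} (hc : c ≠ 0) (A : Matrix ι ι ℝ)
    (hA : ∀ i j, A i j = if i = j then c else 0) :
    A⁻¹ = Matrix.of fun i j ↦ if i = j then c⁻¹ else 0 := by
  have hA' : A = c • (1 : Matrix ι ι ℝ) := by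
    ext i j
    rw [hA i j, Matrix.smul_apply, Matrix.one_apply, smul_eq_mul, mul_ite, mul_one, mul_zero]
  have hB : (Matrix.of fun i j ↦ if i = j then c⁻¹ else (0 : ℝ)) = c⁻¹ • (1 : Matrix ι ι ℝ) := by
    ext i j
    rw [Matrix.of_apply, Matrix.smul_apply, Matrix.one_apply, smul_eq_mul, mul_ite, mul_one,
      mul_zero]
  refine Matrix.inv_eq_right_inv ?_
  rw [hA', hB, Matrix.smul_mul, Matrix.mul_smul, Matrix.one_mul, smul_smul,
    mul_inv_cancel₀ hc, one_smul]

/-- Contraction against the entrywise scalar matrix: `∑ⱼ (c δ)ⱼᵢ Fⱼ = c Fᵢ`. [folklore] -/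
theorem sum_diag_mul {c : ℝ} (F : ι → ℝ) (i : ι) :
    ∑ j, (Matrix.of fun i j ↦ if i = j then c else (0 : ℝ)) j i * F j = c * F i := by
  simp only [Matrix.of_apply, ite_mul, zero_mul, Finset.sum_ite_eq', Finset.mem_univ, if_true]

end Gram

/-! ### Orthonormal bases for a positive definite form -/

section Orthonormal

variable {E : Type*} [AddCommGroup E] [Module ℝ E] [FiniteDimensional ℝ E]

/-- **A positive definite symmetric bilinear form on a `d`-dimensional real vector space has an
orthonormal basis** `β : Fin d → E`, `B(βᵢ, βⱼ) = δᵢⱼ` (Gram–Schmidt; here from Mathlib's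
orthogonal basis `LinearMap.BilinForm.exists_orthogonal_basis`, normalised by
`B(bᵢ, bᵢ)^{-1/2}`, which is possible by positivity). O'Neill 1983, Ch. 3, Lemma 3.24 ff.
(orthonormal bases exist). [folklore] -/
theorem exists_basis_orthonormal_of_posDef {d : ℕ} (hd : Module.finrank ℝ E = d)
    (B : LinearMap.BilinForm ℝ E) (hs : B.IsSymm) (hp : ∀ v : E, v ≠ 0 → 0 < B v v) :
    ∃ β : Module.Basis (Fin d) ℝ E, ∀ i j, B (β i) (β j) = if i = j then 1 else 0 := by
  classical
  obtain ⟨b₀, hb₀⟩ :=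
    LinearMap.BilinForm.exists_orthogonal_basis (LinearMap.BilinForm.isSymm_iff.1 hs)
  set b : Module.Basis (Fin d) ℝ E := b₀.reindex (finCongr hd) with hb_def
  have hb : ∀ i j, i ≠ j → B (b i) (b j) = 0 := by
    intro i j hij
    have h := hb₀ ((finCongr hd).symm.injective.ne hij)
    simp only [Function.onFun] at h
    simpa [hb_def] using h
  have hpos : ∀ i, 0 < B (b i) (b i) := fun i ↦ hp _ (b.ne_zero i)
  -- normalise
  set w : Fin d → ℝˣ := fun i ↦ Units.mk0 (Real.sqrt (B (b i) (b i)))⁻¹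
    (inv_ne_zero (Real.sqrt_pos.2 (hpos i)).ne') with hw
  refine ⟨b.unitsSMul w, fun i j ↦ ?_⟩
  rw [Module.Basis.unitsSMul_apply, Module.Basis.unitsSMul_apply, Units.smul_def, Units.smul_def]
  simp only [map_smul, LinearMap.smul_apply, smul_eq_mul]
  by_cases hij : i = j
  · subst hij
    rw [if_pos rfl, hw, Units.val_mk0]
    have hs0 : Real.sqrt (B (b i) (b i)) ≠ 0 := (Real.sqrt_pos.2 (hpos i)).ne'
    have hsq : Real.sqrt (B (b i) (b i)) * Real.sqrt (B (b i) (b i)) = B (b i) (b i) :=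
      Real.mul_self_sqrt (hpos i).le
    field_simp
    linarith [hsq]
  · rw [if_neg hij, hb i j hij, mul_zero, mul_zero]

end Orthonormal

/-! ### Derivatives of `φ⁴` -/

section PowFour

variable {E : Type*} [NormedAddCommGroup E] [NormedSpace ℝ E] {φ : E → ℝ} {x : E}

/-- `∂ᵥ(φ⁴) = 4 φ³ ∂ᵥφ`. [folklore] -/
theorem fderiv_pow_four_apply (hφ : DifferentiableAt ℝ φ x) (v : E) :
    fderiv ℝ (fun y ↦ φ y ^ 4) x v = 4 * φ x ^ 3 * fderiv ℝ φ x v := by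
  rw [(hφ.hasFDerivAt.pow 4).fderiv]
  simp only [FunLike.coe_smul, Pi.smul_apply, smul_eq_mul, nsmul_eq_mul, Nat.cast_ofNat]

/-- `∂ᵥ∂_w(φ⁴) = 12 φ² ∂ᵥφ ∂_wφ + 4 φ³ ∂ᵥ∂_wφ` for `φ` of class `C²` at `x`. [folklore] -/
theorem fderiv_fderiv_pow_four_apply (hφ : ContDiffAt ℝ 2 φ x) (v w : E) :
    fderiv ℝ (fderiv ℝ (fun y ↦ φ y ^ 4)) x v w =
      12 * φ x ^ 2 * fderiv ℝ φ x v * fderiv ℝ φ x w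
        + 4 * φ x ^ 3 * fderiv ℝ (fderiv ℝ φ) x v w := by
  have hφ1 : DifferentiableAt ℝ φ x := hφ.differentiableAt (by norm_num)
  have hev : ∀ᶠ y in 𝓝 x, DifferentiableAt ℝ φ y := by
    have h1 : ∀ᶠ y in 𝓝 x, ContDiffAt ℝ 2 φ y := hφ.eventually (by simp)
    exact h1.mono fun y hy ↦ hy.differentiableAt (by norm_num)
  have heq : fderiv ℝ (fun y ↦ φ y ^ 4) =ᶠ[𝓝 x] fun y ↦ (4 * φ y ^ 3) • fderiv ℝ φ y := by
    filter_upwards [hev] with y hy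
    rw [(hy.hasFDerivAt.pow 4).fderiv, nsmul_eq_mul, Nat.cast_ofNat]
  have hD : HasFDerivAt (fderiv ℝ φ) (fderiv ℝ (fderiv ℝ φ) x) x :=
    ((hφ.fderiv_right (m := 1) le_rfl).differentiableAt one_ne_zero).hasFDerivAt
  have hc : HasFDerivAt (fun y ↦ 4 * φ y ^ 3) ((4 : ℝ) • ((3 • φ x ^ (3 - 1)) • fderiv ℝ φ x)) x :=
    (hφ1.hasFDerivAt.pow 3).const_mul 4
  have hall : HasFDerivAt (fun y ↦ (4 * φ y ^ 3) • fderiv ℝ φ y) _ x := hc.smul hD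
  rw [heq.fderiv_eq, hall.fderiv]
  simp only [_root_.add_apply, FunLike.coe_smul, Pi.smul_apply, smul_eq_mul,
    ContinuousLinearMap.smulRight_apply, nsmul_eq_mul, Nat.cast_ofNat]
  ring

end PowFour

/-! ### The coordinate formulas in an orthogonal basis -/

section Law

variable {E : Type*} [NormedAddCommGroup E] [NormedSpace ℝ E] [FiniteDimensional ℝ E]
  [CompleteSpace E] {U : Opens E}
  {g : PseudoRiemannianMetric 𝓘(ℝ, E) ∞ E (TangentSpace 𝓘(ℝ, E) : U → Type _)}
  {G : E → E →L[ℝ] E →L[ℝ] ℝ} (hG : ∀ y : U, g.val y = G y)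
  {ι : Type*} [Fintype ι] [DecidableEq ι]

include hG

omit [CompleteSpace E] in
/-- **Index raising in a `G(x)`-orthonormal basis**: `♯(βʲ) = βⱼ` (`gⁱʲ = δⁱʲ`; O'Neill 1983,
Ch. 3, p. 60). [cite: ONeill1983, Ch. 3, p. 60] -/
theorem sharp_coord_of_orthonormal (x : U) (β : Module.Basis ι ℝ E)
    (hβ : ∀ i j, G x (β i) (β j) = if i = j then 1 else 0) (j : ι) :
    g.sharp x (β.coord j) = β j := by
  refine g.sharp_eq_of_forall x _ _ fun w ↦ ?_
  rw [hG x]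
  change G x (β j) w = β.coord j w
  conv_lhs => rw [← β.sum_repr w]
  rw [map_sum]
  simp only [map_smul, smul_eq_mul, hβ, mul_ite, mul_one, mul_zero, Finset.sum_ite_eq,
    Finset.mem_univ, if_true, Module.Basis.coord_apply]

omit [CompleteSpace E] in
/-- **The Christoffel map in a `G(x)`-orthonormal basis**: `Γ_x(q)(p... ) = ∇_q p =
∑ₗ ½ K(p; q, βₗ) βₗ`, i.e. `Γᵏᵢⱼ = ½ K(j; i, k)` when `gᵏˡ = δᵏˡ` (O'Neill 1983, Ch. 3,
Prop. 3.13 (2)). [cite: ONeill1983, Ch. 3, Prop. 3.13] -/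
theorem christoffel_eq_sum_of_orthonormal (x : U) (β : Module.Basis ι ℝ E)
    (hβ : ∀ i j, G x (β i) (β j) = if i = j then 1 else 0) (p q : E) :
    christoffel g G x p q = ∑ l, (2⁻¹ * koszulForm G x p q (β l)) • (β l : E) := by
  rw [christoffel_apply]
  have hval : ∀ v w : E, g.val x v w = G x v w := fun v w ↦ by rw [hG]; rfl
  refine g.sharp_eq_of_forall x _ _ ?_
  intro (w : E)
  rw [hval]
  change G x (∑ l, (2⁻¹ * koszulForm G x p q (β l)) • (β l : E)) w =
    (2 : ℝ)⁻¹ * koszulForm G (x : E) p q w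
  -- both sides are linear in `w`; compare on the expansion of `w`
  conv_lhs => rw [← β.sum_repr w]
  conv_rhs => rw [← β.sum_repr w]
  rw [map_sum, map_sum (koszulForm G (x : E) p q), Finset.mul_sum]
  refine Finset.sum_congr rfl fun m _ ↦ ?_
  rw [map_smul, map_smul, smul_eq_mul, smul_eq_mul]
  suffices hm : G x (∑ l, (2⁻¹ * koszulForm G x p q (β l)) • (β l : E)) (β m) =
      2⁻¹ * koszulForm G (x : E) p q (β m) by
    rw [hm]; ring
  rw [map_sum]
  simp only [map_smul, FunLike.coe_sum, Finset.sum_apply, FunLike.coe_smul, Pi.smul_apply,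
    smul_eq_mul, hβ, mul_ite, mul_one, mul_zero, Finset.sum_ite_eq', Finset.mem_univ, if_true]

omit [CompleteSpace E] in
/-- **The wave operator in a `G(x)`-orthonormal basis**:
`□_g F (x) = ∑ᵢ (∂ᵢ∂ᵢΦ − ½ ∑ₗ K(βᵢ; βᵢ, βₗ) ∂ₗΦ)`, i.e. `Δf = ∑ᵢ (∂ᵢ∂ᵢf − Γˡᵢᵢ ∂ₗ f)` in an
orthonormal frame at `x` (O'Neill 1983, Ch. 3, the display after Def. 3.50, with `gⁱʲ = δⁱʲ`).
[cite: ONeill1983, Ch. 3, Def. 3.50 ff.] -/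
theorem dalembertian_eq_sum_of_orthonormal [g.HasLeviCivita] (x : U)
    (β : Module.Basis ι ℝ E)
    (hβ : ∀ i j, G x (β i) (β j) = if i = j then 1 else 0) {F : U → ℝ} {Φ : E → ℝ}
    (hF : ∀ y : U, F y = Φ y) (hΦ : ContDiffAt ℝ 2 Φ x) :
    g.dalembertian F x =
      ∑ i, (fderiv ℝ (fderiv ℝ Φ) x (β i) (β i)
        - ∑ l, 2⁻¹ * koszulForm G x (β i) (β i) (β l) * fderiv ℝ Φ x (β l)) := by
  rw [dalembertian_eq_sum hG β x (differentiableAt_repr hG x) hF hΦ]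
  refine Finset.sum_congr rfl fun i _ ↦ ?_
  have hcoord : ∀ j, β.coord i (((g.sharp x).toLinearMap : Module.Dual ℝ E →ₗ[ℝ] E) (β.coord j))
      = if j = i then 1 else 0 := fun j ↦ by
    rw [LinearEquiv.coe_coe, sharp_coord_of_orthonormal hG x β hβ j, Module.Basis.coord_apply,
      β.repr_self, Finsupp.single_apply]
  simp only [hcoord, ite_mul, one_mul, zero_mul, Finset.sum_ite_eq', Finset.mem_univ, if_true]
  rw [christoffel_eq_sum_of_orthonormal hG x β hβ, map_sum]
  simp only [map_smul, smul_eq_mul]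

omit [CompleteSpace E] in
/-- `OpensChart.scalarCurvature_eq_coord` (O'Neill 1983, Lemma 3.38 with Def. 3.53) for a basis
of the model space `E` (definitionally the tangent space; restated at `E` so that the entries
`G x (β i) (β j)` can be rewritten). [cite: ONeill1983, Ch. 3, Lemma 3.38 and Def. 3.53] -/
theorem scalarCurvature_eq_coord_basis [g.HasLeviCivita] (x : U) (β : Module.Basis ι ℝ E) :
    g.scalarCurvature x =
      ∑ k, ∑ l, (Matrix.of fun i j ↦ G x (β i) (β j))⁻¹ l k *
        ∑ i, ∑ j, (Matrix.of fun i j ↦ G x (β i) (β j))⁻¹ j i *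
          (2⁻¹ * (fderiv ℝ (fun y ↦ koszulForm G y (β l) (β k) (β j)) x (β i)
              - fderiv ℝ (fun y ↦ koszulForm G y (β l) (β i) (β j)) x (β k))
            - ∑ a, ∑ c, (Matrix.of fun i j ↦ G x (β i) (β j))⁻¹ c a *
                (2⁻¹ * koszulForm G x (β j) (β i) (β c)) * (2⁻¹ * koszulForm G x (β l) (β k) (β a))
            + ∑ a, ∑ c, (Matrix.of fun i j ↦ G x (β i) (β j))⁻¹ c a *
                (2⁻¹ * koszulForm G x (β j) (β k) (β c)) * (2⁻¹ * koszulForm G x (β l) (β i) (β a))) :=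
  scalarCurvature_eq_coord hG x β

omit [CompleteSpace E] in
/-- **The scalar curvature in a `G(x)`-orthogonal basis, polynomial form.** For a smooth metric
on `U` with components `G` and a basis `β` with `G(x)(βᵢ, βⱼ) = c δᵢⱼ`, `c ≠ 0`:
`c³ S(x) = ∑ₖ ∑ᵢ [ c/2 (∂ᵢK(k;k,i) − ∂ₖK(k;i,i)) − ∑ₐ ½K(i;i,a) ½K(k;k,a)
  + ∑ₐ ½K(i;k,a) ½K(k;i,a) ]` — `OpensChart.scalarCurvature_eq_coord` (O'Neill 1983, Lemma 3.38
with Def. 3.53) with `gⁱʲ = c⁻¹ δⁱʲ`, multiplied through by `c³`. [cite: ONeill1983, Ch. 3, Lemma 3.38 and Def. 3.53] -/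
theorem scalarCurvature_eq_coord_of_orthogonal [g.HasLeviCivita] (x : U)
    (β : Module.Basis ι ℝ E) {c : ℝ} (hc : c ≠ 0)
    (hβ : ∀ i j, G x (β i) (β j) = if i = j then c else 0) :
    c ^ 3 * g.scalarCurvature x =
      ∑ k, ∑ i,
        (c / 2 * (fderiv ℝ (fun y ↦ koszulForm G y (β k) (β k) (β i)) x (β i)
            - fderiv ℝ (fun y ↦ koszulForm G y (β k) (β i) (β i)) x (β k))
          - ∑ a, 2⁻¹ * koszulForm G x (β i) (β i) (β a) * (2⁻¹ * koszulForm G x (β k) (β k) (β a))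
          + ∑ a, 2⁻¹ * koszulForm G x (β i) (β k) (β a)
              * (2⁻¹ * koszulForm G x (β k) (β i) (β a))) := by
  have hMinv : (Matrix.of fun i j ↦ G x (β i) (β j))⁻¹ =
      Matrix.of fun i j ↦ if i = j then c⁻¹ else 0 :=
    gram_inv_of_orthogonal hc _ fun i j ↦ by rw [Matrix.of_apply, hβ]
  rw [scalarCurvature_eq_coord_basis hG x β, hMinv, Finset.mul_sum]
  refine Finset.sum_congr rfl fun k _ ↦ ?_
  simp only [Matrix.of_apply, ite_mul, zero_mul, Finset.sum_ite_eq', Finset.mem_univ, if_true]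
  rw [Finset.mul_sum, Finset.mul_sum]
  refine Finset.sum_congr rfl fun i _ ↦ ?_
  simp only [mul_assoc, ← Finset.mul_sum, mul_sub, mul_add]
  field_simp

/-! ### The transformation law -/

omit [CompleteSpace E] in
/-- **The conformal transformation law of scalar curvature in dimension three, in a chart.**
Let `g`, `g'` be smooth metrics on `U ⊆ E`, `dim E = 3`, with components `G` and `f • G`, let
`β` be a `G(x)`-orthonormal basis and let `f` be of class `C²` at `x` with `f x ≠ 0`. Then
`f³ S' = f² S − 2 f □_g f + (3/2) ∑ᵢ (∂_{βᵢ} f)²` at `x`, i.e.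
`S(fg) = f⁻¹ S(g) − 2 f⁻² Δ_g f + (3/2) f⁻³ |df|²_g` — Besse 1987, Thm. 1.159 f)
(`S(e^{2ψ}g) = e^{−2ψ}(S − 2(n−1)Δψ − (n−2)(n−1)|dψ|²)`) with `n = 3` and `f = e^{2ψ}`.
Proof: both sides of `OpensChart.scalarCurvature_eq_coord` in the basis `β`
(`scalarCurvature_eq_coord_of_orthogonal` with `c = f x` and `c = 1`), the Koszul form of
`f • G` and its derivatives expanded (`koszulForm_conformalRepr`,
`fderiv_koszulForm_conformalRepr`), the
second derivatives of `G` cancel and a polynomial identity remains. [cite: Besse1987, Thm. 1.159] -/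
theorem scalarCurvature_conformalRepr [g.HasLeviCivita]
    {g' : PseudoRiemannianMetric 𝓘(ℝ, E) ∞ E (TangentSpace 𝓘(ℝ, E) : U → Type _)}
    [g'.HasLeviCivita] {f : E → ℝ} (hG' : ∀ y : U, g'.val y = f y • G y) (x : U)
    (hf : ContDiffAt ℝ 2 f x) (hfx : f x ≠ 0) (β : Module.Basis (Fin 3) ℝ E)
    (hβ : ∀ i j, G x (β i) (β j) = if i = j then 1 else 0) :
    f x ^ 3 * g'.scalarCurvature x =
      f x ^ 2 * g.scalarCurvature x - 2 * f x * g.dalembertian (fun y : U ↦ f y) x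
        + 3 / 2 * ∑ i, fderiv ℝ f x (β i) ^ 2 := by
  have h2 : (2 : ℕ∞ω) ≤ ∞ := WithTop.coe_le_coe.mpr le_top
  have hG2 : ContDiffAt ℝ 2 G x := (contDiffAt_repr hG x).of_le h2
  have hGx : DifferentiableAt ℝ G x := differentiableAt_repr hG x
  have hf1 : DifferentiableAt ℝ f x := hf.differentiableAt (by norm_num)
  have hβ' : ∀ i j, (fun y ↦ f y • G y) x (β i) (β j) = if i = j then f x else 0 := by
    intro i j
    simp only [FunLike.coe_smul, Pi.smul_apply, smul_eq_mul, hβ, mul_ite, mul_one, mul_zero]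
  have hS' := scalarCurvature_eq_coord_of_orthogonal (G := fun y ↦ f y • G y) hG' x β hfx hβ'
  have hS := scalarCurvature_eq_coord_of_orthogonal hG x β one_ne_zero hβ
  rw [one_pow, one_mul] at hS
  have hΔ := dalembertian_eq_sum_of_orthonormal hG x β hβ (F := fun y : U ↦ f y) (Φ := f)
    (fun _ ↦ rfl) hf
  have hK' : ∀ p q r : E, koszulForm (fun y ↦ f y • G y) x p q r =
      f x * koszulForm G x p q r + fderiv ℝ f x q * G x p r + fderiv ℝ f x p * G x r q
        - fderiv ℝ f x r * G x q p := fun p q r ↦ koszulForm_conformalRepr hf1 hGx p q r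
  have hA' : ∀ v p q r : E, fderiv ℝ (fun y ↦ koszulForm (fun z ↦ f z • G z) y p q r) x v =
      fderiv ℝ f x v * koszulForm G x p q r
        + f x * fderiv ℝ (fun y ↦ koszulForm G y p q r) x v
        + fderiv ℝ (fderiv ℝ f) x v q * G x p r + fderiv ℝ f x q * fderiv ℝ G x v p r
        + fderiv ℝ (fderiv ℝ f) x v p * G x r q + fderiv ℝ f x p * fderiv ℝ G x v r q
        - fderiv ℝ (fderiv ℝ f) x v r * G x q p - fderiv ℝ f x r * fderiv ℝ G x v q p :=
    fun v p q r ↦ fderiv_koszulForm_conformalRepr hf hG2 v p q r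
  -- orthonormality on the frame
  have h00 : G x (β 0) (β 0) = 1 := by rw [hβ]; rfl
  have h11 : G x (β 1) (β 1) = 1 := by rw [hβ]; rfl
  have h22 : G x (β 2) (β 2) = 1 := by rw [hβ]; rfl
  have h01 : G x (β 0) (β 1) = 0 := by rw [hβ]; rfl
  have h02 : G x (β 0) (β 2) = 0 := by rw [hβ]; rfl
  have h12 : G x (β 1) (β 2) = 0 := by rw [hβ]; rfl
  have h10 : G x (β 1) (β 0) = 0 := by rw [hβ]; rfl
  have h20 : G x (β 2) (β 0) = 0 := by rw [hβ]; rfl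
  have h21 : G x (β 2) (β 1) = 0 := by rw [hβ]; rfl
  rw [hS', hS, hΔ]
  simp only [hK', hA', koszulForm_apply G (x : E), Fin.sum_univ_three, h00, h11, h22, h01, h02,
    h12, h10, h20, h21]
  ring

omit [CompleteSpace E] in
/-- **`S(φ⁴ g) = φ⁻⁵ (S(g) φ − 8 □_g φ)` in dimension three, in a chart** — Schoen–Yau 1979,
p. 49: *"The well-known formula for the scalar curvature `R̃` [of `φ⁴ ds²`] is
`R̃ = φ⁻⁵(-8Δφ + Rφ)`"*; Aubin 1982, Ch. 6, §6.3, eq. (1) with `n = 3`; Bartnik–Isenberg 2004,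
§4.1. For smooth metrics `g`, `g'` on `U ⊆ E`, `dim E = 3`, with components `G` and `φ⁴ • G`,
a `G(x)`-orthonormal basis `β` (it exists when `g` is Riemannian,
`exists_basis_orthonormal_of_posDef`) and `φ` of class `C²` at `x` with `φ x ≠ 0`. From
`scalarCurvature_conformalRepr` with `f = φ⁴`: `□(φ⁴) = 4φ³ □φ + 12 φ² |dφ|²`,
`|d(φ⁴)|² = 16 φ⁶ |dφ|²`, and the gradient terms cancel. [cite: SchoenYauPMT1979, §2 Step 1 (p. 49)] -/
theorem scalarCurvature_conformalRepr_fourth_power [g.HasLeviCivita]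
    {g' : PseudoRiemannianMetric 𝓘(ℝ, E) ∞ E (TangentSpace 𝓘(ℝ, E) : U → Type _)}
    [g'.HasLeviCivita] {φ : E → ℝ} (hG' : ∀ y : U, g'.val y = (φ y ^ 4) • G y) (x : U)
    (hφ : ContDiffAt ℝ 2 φ x) (hφx : φ x ≠ 0) (β : Module.Basis (Fin 3) ℝ E)
    (hβ : ∀ i j, G x (β i) (β j) = if i = j then 1 else 0) :
    g'.scalarCurvature x =
      (φ x ^ 5)⁻¹ * (g.scalarCurvature x * φ x - 8 * g.dalembertian (fun y : U ↦ φ y) x) := by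
  have hφ1 : DifferentiableAt ℝ φ x := hφ.differentiableAt (by norm_num)
  have h := scalarCurvature_conformalRepr hG (g' := g') (f := fun y ↦ φ y ^ 4) hG' x (hφ.pow 4)
    (pow_ne_zero 4 hφx) β hβ
  rw [dalembertian_eq_sum_of_orthonormal hG x β hβ (F := fun y : U ↦ φ y ^ 4)
      (Φ := fun y ↦ φ y ^ 4) (fun _ ↦ rfl) (hφ.pow 4)] at h
  rw [dalembertian_eq_sum_of_orthonormal hG x β hβ (F := fun y : U ↦ φ y) (Φ := φ)
      (fun _ ↦ rfl) hφ]
  simp only [fderiv_pow_four_apply hφ1, fderiv_fderiv_pow_four_apply hφ, Fin.sum_univ_three] at h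
  simp only [Fin.sum_univ_three]
  have key : φ x ^ 7 * (φ x ^ 5 * g'.scalarCurvature x) =
      φ x ^ 7 * (g.scalarCurvature x * φ x - 8 *
        (fderiv ℝ (fderiv ℝ φ) x (β 0) (β 0) -
            (2⁻¹ * koszulForm G x (β 0) (β 0) (β 0) * fderiv ℝ φ x (β 0) +
              2⁻¹ * koszulForm G x (β 0) (β 0) (β 1) * fderiv ℝ φ x (β 1) +
              2⁻¹ * koszulForm G x (β 0) (β 0) (β 2) * fderiv ℝ φ x (β 2)) +
          (fderiv ℝ (fderiv ℝ φ) x (β 1) (β 1) -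
            (2⁻¹ * koszulForm G x (β 1) (β 1) (β 0) * fderiv ℝ φ x (β 0) +
              2⁻¹ * koszulForm G x (β 1) (β 1) (β 1) * fderiv ℝ φ x (β 1) +
              2⁻¹ * koszulForm G x (β 1) (β 1) (β 2) * fderiv ℝ φ x (β 2))) +
          (fderiv ℝ (fderiv ℝ φ) x (β 2) (β 2) -
            (2⁻¹ * koszulForm G x (β 2) (β 2) (β 0) * fderiv ℝ φ x (β 0) +
              2⁻¹ * koszulForm G x (β 2) (β 2) (β 1) * fderiv ℝ φ x (β 1) +
              2⁻¹ * koszulForm G x (β 2) (β 2) (β 2) * fderiv ℝ φ x (β 2))))) := by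
    linear_combination h
  have key' := mul_left_cancel₀ (pow_ne_zero 7 hφx) key
  rw [← key']
  field_simp

end Law


end OpensChart

end Literature.Geometry.Lorentzian

end
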